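import Summits.QuantumFields.YangMills.Theorems.BalabanUVNodesN17ShiftModulusCrossover
import Literature.MathematicalPhysics.QuantumFieldTheory.Balaban1983to89.T4TowerRateComposition

/-!
# NODE N17 (NE4) → THE N19′ CORE EDGE OF K3⁷, PART 4: THE SHARP THRESHOLD — the crossover with an injected modulus `r ≤ 1` is summable over the number of
# steps IFF `Σ_j r_j^{σ⋆} < ∞`, `σ⋆ = log(1∕a) ∕ log(Λ∕a)` (each fibre sum is `≍ r_j^{σ⋆}`)

Cell `pub-ymgap`, YM-PLAN Track A (HUMAN RULING D-0062 ∕ D-0149), WIDTH SEAT `pub-ymgap-dag-n17-w2` (gen 3), key K3⁷ stmt-QuantumFields-20544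
(`--kind proof --supports 20544 --as helper`, COUNT-NEUTRAL).  PART 1 (`…N17ShiftModulusCrossover`, p597419) proved SUFFICIENCY strictly below the threshold
(`Σ_j r_j^p < ∞` for some admissible `p < σ⋆`) and ONE witness of failure.  THIS PART makes the threshold EXACT in the crossover regime `0 < a < 1 < Λ` of
`T4Crossover` (`a = L^{−β}` the old-scale contraction of [Balaban1988Convergent] Thm 2 (2.43), `Λ = L⁴` the multiplicity base of [Balaban1987RG1] (0.26)): with
`σ⋆ := log(1∕a) ∕ log(Λ∕a) ∈ ]0,1[` (PART 1 `threshold_pos` ∕ `threshold_lt_one`) and the BALANCE IDENTITY `(a∕Λ)^{σ⋆} = a`, every fibre of the crossover is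
two-sided comparable to `ρ^{σ⋆}`: `a·ρ^{σ⋆} ≤ Σ'_n min(aⁿ, ρ·Λⁿ) ≤ (Λ∕(a(Λ−1)) + 1∕(1−a))·ρ^{σ⋆}` (`0 ≤ ρ ≤ 1`; cut the fibre at the first `n` with `(a∕Λ)ⁿ ≤ ρ`),
whence, by Fubini for non-negative double series over the antidiagonals,

  ★★ `summable_crossover_iff_rpowSummable_threshold`:  for `0 ≤ r_j ≤ 1`,  `Σ_K Σ_{j+n=K} min(aⁿ, r_j·Λⁿ) < ∞  ⟺  Σ_j r_j^{σ⋆} < ∞`.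

So the class of two-run injected moduli node N17 may hand the N19′ edge of record is EXACTLY `ℓ^{σ⋆}` (`σ⋆ < 1`): geometric and stretched-geometric rates are in it,
`1∕(j+1)²` at `(a, Λ) = (1∕2, 2)` (`σ⋆ = 1∕2`) is not (PART 1 §2 re-derived through the iff, §4), and plain summability (`ℓ¹`) is never enough once `Λ > 1`.

WHAT THIS FILE PROVES (theorems only; 0 `def`, 0 `instance`, 0 `notation`, 0 `sorry`).  §1 `summable_antidiagonal_iff_of_nonneg` (antidiagonal sums of a
non-negative `f : ℕ × ℕ → ℝ` are summable over `K` iff `f` is summable — `Finset.HasAntidiagonal.sigmaAntidiagonalEquivProd` + `summable_sigma_of_nonneg`);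
`summable_crossover_iff_summable_fibres` (⟺ `j ↦ Σ'_n min(aⁿ, r_j·Λⁿ)` summable; fibres always summable).  §2 the fibre: `balance_base_rpow` (`(a∕Λ)^{σ⋆} = a`),
`pow_eq_rpow_pow_threshold` (`aⁿ = ((a∕Λ)ⁿ)^{σ⋆}`), `fibre_summable`, ★ `fibre_tsum_le` (upper, any `ρ > 0`), ★ `fibre_tsum_ge` (lower, `0 ≤ ρ ≤ 1`).  §3 ★★ the iff.
§4 corollaries: `summable_crossover_at_threshold` (sufficiency AT `p = σ⋆`, which PART 1's interpolation road misses), `not_summable_crossover_of_not_rpowSummable_threshold`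
(necessity), and PART 1's witness through the iff (`witness_via_threshold`).  §5 THE OTHER CONSUMER of node N17's rate inside the N19′ edge — node U3's COUPLING
BRACKET (`T4TowerRateComposition.historySum_le_rate`: N22's fading memory `T4OutputRate.FadingMemory C₉ ω Λ` of the NE9 history moduli ⊛ the coupling rate `D·θ^i`,
separated rates `ω < θ`) — under a general coupling MODULUS: `couplingModulus_of_injectedModulus` (modulus edition of `couplingRate_of_injectedDisc`: `|g K j − g (K+1) (j+1)| ≤ γ³·r_j`
on the printed box) and ★ `historySum_le_envelope` (an envelope `x` that is ω-SUMMED-REGULAR, `Σ_{i<j} ω^{j−i}·x_i ≤ κ·x_j`, keeps the bracket `≤ C₉·D·κ·x_j` UNIFORMLY in `j`;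
the geometric `θ^j` with `ω < θ` has `κ = ω∕(θ−ω)` by `T4TowerRateComposition.conv_le_of_lt` and gives back the tree's `historySum_le_rate`) — so BOTH places where
the edge of record reads node N17's two-run letter (the U3 bracket against N22's memory rate `ω`, the U4′ crossover against the multiplicity base `Λ`) tolerate exactly
envelopes regular against the relevant rate and, for the crossover, in `ℓ^{σ⋆}`.

HONEST SCOPE (A6, director-ym №189).  Elementary real analysis ([folklore]); the crossover SHAPE of `T4Crossover` with a general modulus; antecedents inhabited
(`r_j = θ^j`); nothing of Bałaban asserted or instantiated; NE4 ∕ NE7 NOT PRINTED and NOT proved; no K2⁷∕K3⁷ stub proved; N17 ∕ N19 NOT discharged; K2⁷ ∕ K3⁷ OPEN;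
counts UNMOVED (typed 28∕28 · discharged 5∕27 · A 5∕28).  One finite four-torus programme at fixed `ε = L^{−K}`, Bałaban AS PRINTED; the YM mass gap (Clay) is NOT
proved by any of this — R4 closes the conditional finite-𝕋⁴ rung `BalabanLadder.UV` only; nothing continuum ∕ ℝ⁴ ∕ OS.
References: [Balaban1987RG1] T. Bałaban, Commun. Math. Phys. **109** (1987), (0.26) p. 257; [Balaban1988Convergent] Commun. Math. Phys. **119** (1988), Thm 2 (2.43) p. 263.
-/

noncomputable section

namespace Summit.QuantumFields.YangMills.BalabanUVNodes.N17ShiftModulusCrossoverSharp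

open Summit.QuantumFields.YangMills.BalabanUVNodes.N17ShiftModulusCrossover (threshold_pos threshold_lt_one)
open Finset

/-! ## §1 Fubini over the antidiagonals -/

/-- ANTIDIAGONAL SUMS OF A NON-NEGATIVE DOUBLE SEQUENCE are summable over `K` iff the double sequence is summable
(`Finset.HasAntidiagonal.sigmaAntidiagonalEquivProd` + `summable_sigma_of_nonneg`; the fibres over each `K` are finite). [folklore] -/
theorem summable_antidiagonal_iff_of_nonneg {f : ℕ × ℕ → ℝ} (hf : ∀ x, 0 ≤ f x) :
    Summable (fun K : ℕ => ∑ x ∈ antidiagonal K, f x) ↔ Summable f := by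
  have h1 : Summable f ↔ Summable (f ∘ (Finset.HasAntidiagonal.sigmaAntidiagonalEquivProd (A := ℕ))) :=
    (Finset.HasAntidiagonal.sigmaAntidiagonalEquivProd (A := ℕ)).summable_iff.symm
  have h2 : Summable (f ∘ (Finset.HasAntidiagonal.sigmaAntidiagonalEquivProd (A := ℕ))) ↔
      (∀ K : ℕ, Summable fun y : {x // x ∈ antidiagonal K} => (f ∘ Finset.HasAntidiagonal.sigmaAntidiagonalEquivProd) ⟨K, y⟩) ∧
        Summable fun K : ℕ => ∑' y : {x // x ∈ antidiagonal K}, (f ∘ Finset.HasAntidiagonal.sigmaAntidiagonalEquivProd) ⟨K, y⟩ :=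
    summable_sigma_of_nonneg fun x => hf _
  rw [h1, h2]
  have hfib : ∀ K : ℕ, ∑' y : {x // x ∈ antidiagonal K}, (f ∘ Finset.HasAntidiagonal.sigmaAntidiagonalEquivProd) ⟨K, y⟩
      = ∑ x ∈ antidiagonal K, f x := fun K => Finset.tsum_subtype (antidiagonal K) f
  constructor
  · intro h
    refine ⟨fun K => (hasSum_fintype _).summable, ?_⟩
    exact h.congr fun K => (hfib K).symm
  · rintro ⟨-, h⟩
    exact h.congr fun K => hfib K

/-- the crossover's double sequence is non-negative. [folklore] -/
theorem crossover_term_nonneg {a Λ : ℝ} {r : ℕ → ℝ} (ha : 0 ≤ a) (hΛ : 0 ≤ Λ) (hr : ∀ j, 0 ≤ r j) (x : ℕ × ℕ) :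
    0 ≤ min (a ^ x.2) (r x.1 * Λ ^ x.2) :=
  le_min (pow_nonneg ha _) (mul_nonneg (hr _) (pow_nonneg hΛ _))

/-- every FIBRE `n ↦ min(aⁿ, ρ·Λⁿ)` is summable for `0 ≤ a < 1` (dominated by `aⁿ`). [folklore] -/
theorem fibre_summable {a Λ ρ : ℝ} (ha0 : 0 ≤ a) (ha1 : a < 1) (hΛ : 0 ≤ Λ) (hρ : 0 ≤ ρ) :
    Summable fun n : ℕ => min (a ^ n) (ρ * Λ ^ n) :=
  Summable.of_nonneg_of_le (fun k => le_min (pow_nonneg ha0 k) (mul_nonneg hρ (pow_nonneg hΛ k))) (fun k => min_le_left (a ^ k) _)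
    (summable_geometric_of_lt_one ha0 ha1)

/-- THE CROSSOVER IS SUMMABLE OVER `K` IFF ITS FIBRE SUMS ARE SUMMABLE OVER `j` (Fubini for non-negative double series, `Equiv.sigmaEquivProd` + `summable_sigma_of_nonneg`). [folklore] -/
theorem summable_crossover_iff_summable_fibres {a Λ : ℝ} {r : ℕ → ℝ} (ha0 : 0 ≤ a) (ha1 : a < 1) (hΛ : 0 ≤ Λ) (hr : ∀ j, 0 ≤ r j) :
    Summable (fun K : ℕ => ∑ x ∈ antidiagonal K, min (a ^ x.2) (r x.1 * Λ ^ x.2))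
      ↔ Summable fun j : ℕ => ∑' n : ℕ, min (a ^ n) (r j * Λ ^ n) := by
  have hg0 : ∀ x : ℕ × ℕ, 0 ≤ min (a ^ x.2) (r x.1 * Λ ^ x.2) := fun x => crossover_term_nonneg ha0 hΛ hr x
  rw [summable_antidiagonal_iff_of_nonneg hg0]
  rw [show (Summable fun x : ℕ × ℕ => min (a ^ x.2) (r x.1 * Λ ^ x.2)) ↔
      (∀ j, Summable fun n : ℕ => min (a ^ n) (r j * Λ ^ n)) ∧ Summable fun j => ∑' n : ℕ, min (a ^ n) (r j * Λ ^ n) from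
    (Equiv.sigmaEquivProd ℕ ℕ).summable_iff.symm.trans (summable_sigma_of_nonneg fun x => hg0 _)]
  exact ⟨fun h => h.2, fun h => ⟨fun j => fibre_summable ha0 ha1 hΛ (hr j), h⟩⟩

/-! ## §2 The fibre sum is two-sided comparable to `ρ^{σ⋆}` -/

section Fibre

variable {a Λ : ℝ}

/-- THE BALANCE IDENTITY: `(a∕Λ)^{σ⋆} = a` for `σ⋆ = log(1∕a)∕log(Λ∕a)`, `0 < a < 1 < Λ`. [folklore] -/
theorem balance_base_rpow (ha0 : 0 < a) (ha1 : a < 1) (hΛ : 1 < Λ) :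
    (a / Λ) ^ (Real.log (1 / a) / Real.log (Λ / a)) = a := by
  have hΛ0 : 0 < Λ := one_pos.trans hΛ
  have haΛ : 0 < a / Λ := div_pos ha0 hΛ0
  have hlog : Real.log (Λ / a) ≠ 0 := by
    have : 0 < Real.log (Λ / a) := Real.log_pos (by rw [lt_div_iff₀ ha0, one_mul]; linarith)
    exact this.ne'
  refine Real.log_injOn_pos (Set.mem_Ioi.mpr (Real.rpow_pos_of_pos haΛ _)) (Set.mem_Ioi.mpr ha0) ?_
  rw [Real.log_rpow haΛ]
  have h1 : Real.log (a / Λ) = -Real.log (Λ / a) := by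
    rw [Real.log_div ha0.ne' hΛ0.ne', Real.log_div hΛ0.ne' ha0.ne']; ring
  have h2 : Real.log (1 / a) = -Real.log a := by rw [one_div, Real.log_inv]
  rw [h1, h2]
  field_simp

/-- consequence: `aⁿ = ((a∕Λ)ⁿ)^{σ⋆}` — powers of the contraction ARE threshold-powers of the powers of `a∕Λ`. [folklore] -/
theorem pow_eq_rpow_pow_threshold (ha0 : 0 < a) (ha1 : a < 1) (hΛ : 1 < Λ) (n : ℕ) :
    a ^ n = ((a / Λ) ^ n) ^ (Real.log (1 / a) / Real.log (Λ / a)) := by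
  have haΛ : 0 ≤ a / Λ := (div_pos ha0 (one_pos.trans hΛ)).le
  rw [← Real.rpow_pow_comm haΛ, balance_base_rpow ha0 ha1 hΛ]

/-- ★ **UPPER FIBRE BOUND**: for `0 < a < 1 < Λ` and `ρ > 0`, `Σ'_n min(aⁿ, ρ·Λⁿ) ≤ (Λ∕(a·(Λ−1)) + 1∕(1−a))·ρ^{σ⋆}`.  Cut at the FIRST `n₀` with `(a∕Λ)^{n₀} ≤ ρ`
(`Nat.find`): below it the fibre is `≤ ρΛⁿ`, a geometric sum `≤ ρΛ^{n₀}∕(Λ−1) < (Λ∕a)·a^{n₀}∕(Λ−1)` (minimality), above it `≤ aⁿ`, summing to `a^{n₀}∕(1−a)`; and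
`a^{n₀} = ((a∕Λ)^{n₀})^{σ⋆} ≤ ρ^{σ⋆}` by the balance identity. [folklore] -/
theorem fibre_tsum_le (ha0 : 0 < a) (ha1 : a < 1) (hΛ : 1 < Λ) {ρ : ℝ} (hρ : 0 < ρ) :
    ∑' n : ℕ, min (a ^ n) (ρ * Λ ^ n) ≤ (Λ / (a * (Λ - 1)) + 1 / (1 - a)) * ρ ^ (Real.log (1 / a) / Real.log (Λ / a)) := by
  set σ : ℝ := Real.log (1 / a) / Real.log (Λ / a) with hσ
  have hσ0 : 0 < σ := threshold_pos ha0 ha1 hΛ.le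
  have hΛ0 : 0 < Λ := one_pos.trans hΛ
  have hq0 : 0 ≤ a / Λ := (div_pos ha0 hΛ0).le
  have hq1 : a / Λ < 1 := (div_lt_one hΛ0).mpr (ha1.trans hΛ)
  -- the first index with `(a/Λ)^n ≤ ρ`
  have hex : ∃ n : ℕ, (a / Λ) ^ n ≤ ρ := by
    obtain ⟨n, hn⟩ := exists_pow_lt_of_lt_one hρ hq1
    exact ⟨n, hn.le⟩
  obtain ⟨n₀, hn₀spec, hmin⟩ : ∃ n₀ : ℕ, (a / Λ) ^ n₀ ≤ ρ ∧ ∀ m, m < n₀ → ρ < (a / Λ) ^ m :=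
    ⟨Nat.find hex, Nat.find_spec hex, fun m hm => lt_of_not_ge (Nat.find_min hex hm)⟩
  -- `a^{n₀} ≤ ρ^σ`
  have hkey : a ^ n₀ ≤ ρ ^ σ := by
    rw [pow_eq_rpow_pow_threshold ha0 ha1 hΛ n₀]
    exact Real.rpow_le_rpow (pow_nonneg hq0 _) hn₀spec hσ0.le
  have hρσ : 0 ≤ ρ ^ σ := Real.rpow_nonneg hρ.le _
  -- split the fibre at `n₀`
  have hfs : Summable fun n : ℕ => min (a ^ n) (ρ * Λ ^ n) := fibre_summable ha0.le ha1 hΛ0.le hρ.le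
  rw [← hfs.sum_add_tsum_nat_add n₀]
  -- head: `Σ_{n<n₀} min ≤ Σ_{n<n₀} ρΛⁿ = ρ(Λ^{n₀}−1)/(Λ−1) ≤ (Λ/(a(Λ−1)))·a^{n₀}`
  have hhead : ∑ n ∈ range n₀, min (a ^ n) (ρ * Λ ^ n) ≤ Λ / (a * (Λ - 1)) * ρ ^ σ := by
    have h1 : ∑ n ∈ range n₀, min (a ^ n) (ρ * Λ ^ n) ≤ ∑ n ∈ range n₀, ρ * Λ ^ n := Finset.sum_le_sum fun n _ => min_le_right _ _
    have h2 : ∑ n ∈ range n₀, ρ * Λ ^ n = ρ * ((Λ ^ n₀ - 1) / (Λ - 1)) := by rw [← Finset.mul_sum, geom_sum_eq hΛ.ne' n₀]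
    rcases Nat.eq_zero_or_pos n₀ with hz | hpos
    · rw [hz, Finset.sum_range_zero]
      exact mul_nonneg (div_nonneg hΛ0.le (mul_nonneg ha0.le (by linarith))) hρσ
    · -- minimality at `n₀ - 1`: `ρ < (a/Λ)^{n₀-1}`, so `ρ Λ^{n₀} < Λ · a^{n₀-1} = (Λ/a) a^{n₀}`
      obtain ⟨m, rfl⟩ : ∃ m, n₀ = m + 1 := ⟨n₀ - 1, by omega⟩
      have hm := hmin m (by omega)
      have hΛpow : 0 < Λ ^ (m + 1) := pow_pos hΛ0 _
      have hρΛ : ρ * Λ ^ (m + 1) ≤ Λ / a * a ^ (m + 1) := by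
        have e1 : (a / Λ) ^ m * Λ ^ (m + 1) = Λ / a * a ^ (m + 1) := by
          rw [div_pow, pow_succ, pow_succ]
          field_simp
        calc ρ * Λ ^ (m + 1) ≤ (a / Λ) ^ m * Λ ^ (m + 1) := mul_le_mul_of_nonneg_right hm.le hΛpow.le
          _ = Λ / a * a ^ (m + 1) := e1
      calc ∑ n ∈ range (m + 1), min (a ^ n) (ρ * Λ ^ n) ≤ ρ * ((Λ ^ (m + 1) - 1) / (Λ - 1)) := h1.trans_eq h2
        _ ≤ ρ * (Λ ^ (m + 1) / (Λ - 1)) := by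
            refine mul_le_mul_of_nonneg_left (div_le_div_of_nonneg_right (by linarith) (by linarith)) hρ.le
        _ = ρ * Λ ^ (m + 1) / (Λ - 1) := by ring
        _ ≤ Λ / a * a ^ (m + 1) / (Λ - 1) := div_le_div_of_nonneg_right hρΛ (by linarith)
        _ ≤ Λ / a * ρ ^ σ / (Λ - 1) := by
            refine div_le_div_of_nonneg_right (mul_le_mul_of_nonneg_left hkey (div_nonneg hΛ0.le ha0.le)) (by linarith)
        _ = Λ / (a * (Λ - 1)) * ρ ^ σ := by
            field_simp
  -- tail: `Σ' k, min(a^{k+n₀}, …) ≤ Σ' k, a^{k+n₀} = a^{n₀}/(1−a) ≤ ρ^σ/(1−a)`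
  have htail : ∑' k : ℕ, min (a ^ (k + n₀)) (ρ * Λ ^ (k + n₀)) ≤ 1 / (1 - a) * ρ ^ σ := by
    have hg : Summable fun k : ℕ => a ^ n₀ * a ^ k := (summable_geometric_of_lt_one ha0.le ha1).mul_left _
    have hdom : ∀ k : ℕ, min (a ^ (k + n₀)) (ρ * Λ ^ (k + n₀)) ≤ a ^ n₀ * a ^ k := fun k => by
      rw [pow_add, mul_comm]; exact min_le_left _ _
    have hs : Summable fun k : ℕ => min (a ^ (k + n₀)) (ρ * Λ ^ (k + n₀)) :=
      Summable.of_nonneg_of_le (fun k => le_min (pow_nonneg ha0.le _) (mul_nonneg hρ.le (pow_nonneg hΛ0.le _))) hdom hg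
    calc ∑' k : ℕ, min (a ^ (k + n₀)) (ρ * Λ ^ (k + n₀)) ≤ ∑' k : ℕ, a ^ n₀ * a ^ k := hs.tsum_le_tsum hdom hg
      _ = a ^ n₀ * (1 - a)⁻¹ := by rw [tsum_mul_left, tsum_geometric_of_lt_one ha0.le ha1]
      _ ≤ ρ ^ σ * (1 - a)⁻¹ := mul_le_mul_of_nonneg_right hkey (inv_nonneg.mpr (by linarith))
      _ = 1 / (1 - a) * ρ ^ σ := by rw [one_div]; ring
  calc ∑ n ∈ range n₀, min (a ^ n) (ρ * Λ ^ n) + ∑' k : ℕ, min (a ^ (k + n₀)) (ρ * Λ ^ (k + n₀))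
      ≤ Λ / (a * (Λ - 1)) * ρ ^ σ + 1 / (1 - a) * ρ ^ σ := add_le_add hhead htail
    _ = (Λ / (a * (Λ - 1)) + 1 / (1 - a)) * ρ ^ σ := by ring

/-- ★ **LOWER FIBRE BOUND**: for `0 < a < 1 < Λ` and `0 ≤ ρ ≤ 1`, `a·ρ^{σ⋆} ≤ Σ'_n min(aⁿ, ρ·Λⁿ)` — read the single term at the first `n₀` with `(a∕Λ)^{n₀} ≤ ρ`: there
`min = a^{n₀}` and `a^{n₀} = a·a^{n₀−1} ≥ a·((a∕Λ)^{n₀−1})^{σ⋆} ≥ a·ρ^{σ⋆}` by minimality (for `n₀ = 0`: `1 ≥ ρ^{σ⋆}`). [folklore] -/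
theorem fibre_tsum_ge (ha0 : 0 < a) (ha1 : a < 1) (hΛ : 1 < Λ) {ρ : ℝ} (hρ0 : 0 ≤ ρ) (hρ1 : ρ ≤ 1) :
    a * ρ ^ (Real.log (1 / a) / Real.log (Λ / a)) ≤ ∑' n : ℕ, min (a ^ n) (ρ * Λ ^ n) := by
  set σ : ℝ := Real.log (1 / a) / Real.log (Λ / a) with hσ
  have hσ0 : 0 < σ := threshold_pos ha0 ha1 hΛ.le
  have hΛ0 : 0 < Λ := one_pos.trans hΛ
  have hq0 : 0 ≤ a / Λ := (div_pos ha0 hΛ0).le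
  have hq1 : a / Λ < 1 := (div_lt_one hΛ0).mpr (ha1.trans hΛ)
  have hρσ1 : ρ ^ σ ≤ 1 := Real.rpow_le_one hρ0 hρ1 hσ0.le
  rcases eq_or_lt_of_le hρ0 with hz | hρ
  · -- `ρ = 0`: both sides vanish
    rw [← hz, Real.zero_rpow hσ0.ne', mul_zero]
    exact tsum_nonneg fun n => le_min (pow_nonneg ha0.le _) (by rw [zero_mul])
  have hex : ∃ n : ℕ, (a / Λ) ^ n ≤ ρ := by
    obtain ⟨n, hn⟩ := exists_pow_lt_of_lt_one hρ hq1
    exact ⟨n, hn.le⟩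
  obtain ⟨n₀, hn₀spec, hmin⟩ : ∃ n₀ : ℕ, (a / Λ) ^ n₀ ≤ ρ ∧ ∀ m, m < n₀ → ρ < (a / Λ) ^ m :=
    ⟨Nat.find hex, Nat.find_spec hex, fun m hm => lt_of_not_ge (Nat.find_min hex hm)⟩
  have hfs : Summable fun n : ℕ => min (a ^ n) (ρ * Λ ^ n) := fibre_summable ha0.le ha1 hΛ0.le hρ.le
  -- the term at `n₀` is `a^{n₀}` (since `(a/Λ)^{n₀} ≤ ρ` means `a^{n₀} ≤ ρ Λ^{n₀}`)
  have hterm : min (a ^ n₀) (ρ * Λ ^ n₀) = a ^ n₀ := by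
    refine min_eq_left ?_
    have h := mul_le_mul_of_nonneg_right hn₀spec (pow_pos hΛ0 n₀).le
    rwa [div_pow, div_mul_cancel₀ _ (pow_pos hΛ0 n₀).ne'] at h
  have hsingle : min (a ^ n₀) (ρ * Λ ^ n₀) ≤ ∑' n : ℕ, min (a ^ n) (ρ * Λ ^ n) := by
    have h := hfs.sum_le_tsum {n₀} (fun n _ => le_min (pow_nonneg ha0.le _) (mul_nonneg hρ.le (pow_nonneg hΛ0.le _)))
    rwa [Finset.sum_singleton] at h
  refine le_trans ?_ (hterm ▸ hsingle)
  -- `a ρ^σ ≤ a^{n₀}`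
  rcases Nat.eq_zero_or_pos n₀ with hz | hpos
  · rw [hz, pow_zero]
    calc a * ρ ^ σ ≤ a * 1 := mul_le_mul_of_nonneg_left hρσ1 ha0.le
      _ ≤ 1 := by linarith
  · obtain ⟨m, rfl⟩ : ∃ m, n₀ = m + 1 := ⟨n₀ - 1, by omega⟩
    have hm := hmin m (by omega)
    have h1 : ρ ^ σ ≤ ((a / Λ) ^ m) ^ σ := Real.rpow_le_rpow hρ.le hm.le hσ0.le
    rw [← pow_eq_rpow_pow_threshold ha0 ha1 hΛ m] at h1
    rw [pow_succ']
    exact mul_le_mul_of_nonneg_left h1 ha0.le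

end Fibre

/-! ## §3 The sharp threshold -/

/-- ★★ **THE SHARP TRANSPORT THRESHOLD.**  In the crossover regime `0 < a < 1 < Λ`, for an injected modulus `0 ≤ r_j ≤ 1`, the crossover sums
`K ↦ Σ_{j+n=K} min(aⁿ, r_j·Λⁿ)` are summable over the number of steps `K` IF AND ONLY IF `Σ_j r_j^{σ⋆} < ∞`, `σ⋆ = log(1∕a)∕log(Λ∕a)` (`∈ ]0,1[`).  (§1 Fubini +
§2's two-sided fibre comparison.)  The class of moduli node N17 may hand the N19′ edge of record through the crossover is exactly `ℓ^{σ⋆}`. [folklore] -/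
theorem summable_crossover_iff_rpowSummable_threshold {a Λ : ℝ} {r : ℕ → ℝ} (ha0 : 0 < a) (ha1 : a < 1) (hΛ : 1 < Λ)
    (hr0 : ∀ j, 0 ≤ r j) (hr1 : ∀ j, r j ≤ 1) :
    Summable (fun K : ℕ => ∑ x ∈ antidiagonal K, min (a ^ x.2) (r x.1 * Λ ^ x.2))
      ↔ Summable fun j : ℕ => r j ^ (Real.log (1 / a) / Real.log (Λ / a)) := by
  have hΛ0 : 0 ≤ Λ := (one_pos.trans hΛ).le
  set σ : ℝ := Real.log (1 / a) / Real.log (Λ / a) with hσ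
  set CU : ℝ := Λ / (a * (Λ - 1)) + 1 / (1 - a) with hCU
  rw [summable_crossover_iff_summable_fibres ha0.le ha1 hΛ0 hr0]
  have hfib0 : ∀ j, 0 ≤ ∑' n : ℕ, min (a ^ n) (r j * Λ ^ n) := fun j =>
    tsum_nonneg fun n => le_min (pow_nonneg ha0.le _) (mul_nonneg (hr0 j) (pow_nonneg hΛ0 _))
  constructor
  · -- fibres summable ⟹ `r^σ` summable (lower bound, `r ≤ 1`)
    intro h
    have h' : Summable fun j => a⁻¹ * ∑' n : ℕ, min (a ^ n) (r j * Λ ^ n) := h.mul_left _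
    refine Summable.of_nonneg_of_le (fun j => Real.rpow_nonneg (hr0 j) _) (fun j => ?_) h'
    have hlow := fibre_tsum_ge ha0 ha1 hΛ (hr0 j) (hr1 j)
    rw [← hσ] at hlow
    calc r j ^ σ = a⁻¹ * (a * r j ^ σ) := by field_simp
      _ ≤ a⁻¹ * ∑' n : ℕ, min (a ^ n) (r j * Λ ^ n) := mul_le_mul_of_nonneg_left hlow (inv_nonneg.mpr ha0.le)
  · -- `r^σ` summable ⟹ fibres summable (upper bound; at `r_j = 0` the fibre vanishes)
    intro h
    refine Summable.of_nonneg_of_le hfib0 (fun j => ?_) (h.mul_left CU)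
    rcases eq_or_lt_of_le (hr0 j) with hz | hpos
    · have hfib : ∑' n : ℕ, min (a ^ n) (r j * Λ ^ n) = 0 := by
        have : ∀ n : ℕ, min (a ^ n) (r j * Λ ^ n) = 0 := fun n => by
          rw [← hz, zero_mul]; exact min_eq_right (pow_nonneg ha0.le _)
        simp only [this, tsum_zero]
      rw [hfib]
      exact mul_nonneg (by
        have h1 : 0 ≤ Λ / (a * (Λ - 1)) := div_nonneg hΛ0 (mul_nonneg ha0.le (by linarith))
        have h2 : 0 ≤ 1 / (1 - a) := div_nonneg zero_le_one (by linarith)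
        simpa [hCU] using add_nonneg h1 h2) (Real.rpow_nonneg (hr0 j) _)
    · have hup := fibre_tsum_le ha0 ha1 hΛ hpos
      rw [← hσ] at hup
      simpa [hCU] using hup

/-! ## §4 Corollaries: the threshold exponent itself transports; necessity; PART 1's witness through the iff -/

/-- SUFFICIENCY AT THE THRESHOLD EXPONENT ITSELF (`p = σ⋆`, which PART 1's interpolation road `summable_crossover_of_rpowSummable` misses: there the ratio
`a^{1−p}Λ^p` must be `< 1`, i.e. `p < σ⋆`). [folklore] -/
theorem summable_crossover_at_threshold {a Λ : ℝ} {r : ℕ → ℝ} (ha0 : 0 < a) (ha1 : a < 1) (hΛ : 1 < Λ) (hr0 : ∀ j, 0 ≤ r j) (hr1 : ∀ j, r j ≤ 1)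
    (hs : Summable fun j : ℕ => r j ^ (Real.log (1 / a) / Real.log (Λ / a))) :
    Summable (fun K : ℕ => ∑ x ∈ antidiagonal K, min (a ^ x.2) (r x.1 * Λ ^ x.2)) :=
  (summable_crossover_iff_rpowSummable_threshold ha0 ha1 hΛ hr0 hr1).mpr hs

/-- NECESSITY: a modulus `0 ≤ r ≤ 1` with `Σ_j r_j^{σ⋆} = ∞` does NOT survive the crossover. [folklore] -/
theorem not_summable_crossover_of_not_rpowSummable_threshold {a Λ : ℝ} {r : ℕ → ℝ} (ha0 : 0 < a) (ha1 : a < 1) (hΛ : 1 < Λ)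
    (hr0 : ∀ j, 0 ≤ r j) (hr1 : ∀ j, r j ≤ 1) (hs : ¬ Summable fun j : ℕ => r j ^ (Real.log (1 / a) / Real.log (Λ / a))) :
    ¬ Summable (fun K : ℕ => ∑ x ∈ antidiagonal K, min (a ^ x.2) (r x.1 * Λ ^ x.2)) :=
  fun h => hs ((summable_crossover_iff_rpowSummable_threshold ha0 ha1 hΛ hr0 hr1).mp h)

/-- the threshold exponent at PART 1's witness pair `(a, Λ) = (1∕2, 2)` is `σ⋆ = log 2 ∕ log 4 = 1∕2`. [folklore] -/
theorem threshold_witness_eq_half : Real.log (1 / (1 / 2 : ℝ)) / Real.log (2 / (1 / 2 : ℝ)) = 1 / 2 := by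
  have h4 : (2 / (1 / 2 : ℝ)) = 2 ^ 2 := by norm_num
  rw [one_div_one_div, h4, Real.log_pow]
  have h2 : 0 < Real.log 2 := Real.log_pos one_lt_two
  field_simp
  ring

/-- PART 1's LOCATED NEGATIVE THROUGH THE IFF: at `(a, Λ) = (1∕2, 2)` the summable modulus `r_j = 1∕(j+1)²` has `r_j^{σ⋆} = r_j^{1∕2} = 1∕(j+1)`, NOT summable
(harmonic), hence its crossover is NOT summable — `…N17ShiftModulusCrossover.summableModulus_not_sufficient_for_crossover`'s second half, re-derived. [folklore] -/
theorem witness_via_threshold :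
    ¬ Summable (fun K : ℕ => ∑ x ∈ antidiagonal K, min ((1 / 2 : ℝ) ^ x.2) (1 / ((x.1 : ℝ) + 1) ^ 2 * 2 ^ x.2)) := by
  refine not_summable_crossover_of_not_rpowSummable_threshold (r := fun j : ℕ => 1 / ((j : ℝ) + 1) ^ 2) (by norm_num) (by norm_num) (by norm_num)
    (fun j => by positivity) (fun j => ?_) ?_
  · rw [div_le_one (by positivity)]
    have : (0 : ℝ) ≤ j := Nat.cast_nonneg j
    nlinarith
  · rw [threshold_witness_eq_half]
    intro hs
    have hs' : Summable fun j : ℕ => (fun m : ℕ => 1 / (m : ℝ)) (j + 1) := by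
      refine hs.congr fun j => ?_
      have hj : (0 : ℝ) ≤ (j : ℝ) + 1 := by positivity
      push_cast
      rw [one_div, Real.inv_rpow (pow_nonneg hj 2), ← Real.rpow_natCast_mul hj]
      norm_num
    exact Real.not_summable_one_div_natCast ((summable_nat_add_iff 1).mp hs')

/-! ## §5 The other consumer of node N17's rate inside the N19′ edge: node U3's coupling bracket (N22's fading memory ⊛ the coupling modulus) -/

section Bracket

open Literature.MathematicalPhysics.QuantumFieldTheory.Balaban1983to89
open Literature.MathematicalPhysics.QuantumFieldTheory.Balaban1983to89.T4OutputRate (FadingMemory)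
open Literature.MathematicalPhysics.QuantumFieldTheory.Balaban1983to89.T4TowerRateComposition (fadingMemory_const_nonneg)

/-- NODE U2's OUTPUT IN MODULUS FORM ⟹ THE COUPLING MODULUS (modulus edition of `T4TowerRateComposition.couplingRate_of_injectedDisc`): a K-uniform bound
`0 ≤ disc (g K) (g (K+1)) j ≤ r_j` (`j ≤ K`; PART 2 ∕ PART 3 produce it with `r` = the tails resp. twice the envelope of the full-β shift modulus) on the printed box
`0 < g ≤ γ` gives `|g^{(K)}_j − g^{(K+1)}_{j+1}| ≤ γ³·r_j` (`T4CouplingMatching.abs_sub_le_of_inv_sq`). [cite: Balaban1987RG1, (0.30) p.258] -/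
theorem couplingModulus_of_injectedModulus {γ : ℝ} {r : ℕ → ℝ} {g : ℕ → ℕ → ℝ}
    (h : ∀ K j : ℕ, j ≤ K → 0 ≤ T4CouplingMatching.disc (g K) (g (K + 1)) j ∧ T4CouplingMatching.disc (g K) (g (K + 1)) j ≤ r j)
    (hbox : ∀ K i, i ≤ K → 0 < g K i ∧ g K i ≤ γ) {K j : ℕ} (hj : j ≤ K) :
    |g K j - g (K + 1) (j + 1)| ≤ γ ^ 3 * r j := by
  have hd := (h K j hj).2
  simp only [T4CouplingMatching.disc] at hd
  obtain ⟨ha, haγ⟩ := hbox K j hj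
  obtain ⟨hb, hbγ⟩ := hbox (K + 1) (j + 1) (Nat.succ_le_succ hj)
  have hγ : 0 ≤ γ := ha.le.trans haγ
  have h1 := T4CouplingMatching.abs_sub_le_of_inv_sq ha hb
  have hw : g K j ^ 2 * g (K + 1) (j + 1) ≤ γ ^ 3 := by
    have h2 : g K j ^ 2 ≤ γ ^ 2 := pow_le_pow_left₀ ha.le haγ 2
    calc g K j ^ 2 * g (K + 1) (j + 1) ≤ γ ^ 2 * γ := mul_le_mul h2 hbγ hb.le (sq_nonneg γ)
      _ = γ ^ 3 := by ring
  calc |g K j - g (K + 1) (j + 1)|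
      ≤ g K j ^ 2 * g (K + 1) (j + 1) * |1 / g K j ^ 2 - 1 / g (K + 1) (j + 1) ^ 2| := h1
    _ ≤ γ ^ 3 * r j := mul_le_mul hw hd (abs_nonneg _) (pow_nonneg hγ 3)

/-- ★ **NODE U3's COUPLING BRACKET UNDER A MODULUS WITH AN ω-SUMMED-REGULAR ENVELOPE** (modulus edition of `T4TowerRateComposition.historySum_le_rate`): N22's fading memory
`Λ j i ≤ C₉·ω^{j−i}` of the NE9 history moduli, a coupling modulus `|g^A_i − g^B_i| ≤ D·x_i` (`i < j`) and an envelope with `Σ_{i<j} ω^{j−i}·x_i ≤ κ·x_j` give the history sum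
`Σ_{i<j} Λ j i·|g^A_i − g^B_i| ≤ C₉·D·κ·x_j` — UNIFORM in `j` and in the number of steps (the `hb`-type input of `T4OutputRate.u3_geometric` keeps its shape with `x_j` for `θ^j`).
Summed regularity holds for every geometric `ρ^j` with `ρ > ω` (`κ = ω∕(ρ−ω)`, `T4TowerRateComposition.conv_le_of_lt` — at `x = θ^·` this theorem IS the tree's
`historySum_le_rate`, not restated) and every polynomial envelope; it FAILS for envelopes decaying faster than `ω^j`. [folklore] -/
theorem historySum_le_envelope {C₉ ω D κ : ℝ} {Λm : ℕ → ℕ → ℝ} {x : ℕ → ℝ} (hΛ : FadingMemory C₉ ω Λm) (hD : 0 ≤ D)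
    (hreg : ∀ j : ℕ, ∑ i ∈ range j, ω ^ (j - i) * x i ≤ κ * x j)
    {gA gB : ℕ → ℝ} {j : ℕ} (he : ∀ i, i < j → |gA i - gB i| ≤ D * x i) :
    ∑ i ∈ range j, Λm j i * |gA i - gB i| ≤ C₉ * D * κ * x j := by
  have hC9 := fadingMemory_const_nonneg hΛ
  have step : ∀ i ∈ range j, Λm j i * |gA i - gB i| ≤ C₉ * D * (ω ^ (j - i) * x i) := by
    intro i hi
    have hij := mem_range.mp hi
    obtain ⟨h0, h1⟩ := hΛ j i hij.le
    calc Λm j i * |gA i - gB i| ≤ (C₉ * ω ^ (j - i)) * (D * x i) := mul_le_mul h1 (he i hij) (abs_nonneg _) (h0.trans h1)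
      _ = C₉ * D * (ω ^ (j - i) * x i) := by ring
  calc ∑ i ∈ range j, Λm j i * |gA i - gB i| ≤ ∑ i ∈ range j, C₉ * D * (ω ^ (j - i) * x i) := Finset.sum_le_sum step
    _ = C₉ * D * ∑ i ∈ range j, ω ^ (j - i) * x i := by rw [Finset.mul_sum]
    _ ≤ C₉ * D * (κ * x j) := mul_le_mul_of_nonneg_left (hreg j) (mul_nonneg hC9 hD)
    _ = C₉ * D * κ * x j := by ring

end Bracket

end Summit.QuantumFields.YangMills.BalabanUVNodes.N17ShiftModulusCrossoverSharp

end
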